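import Summits.HodgeConjecture.HodgeConjecture.Theorems.Ring2AbelianAllAndreWeilFieldTransport
import Summits.HodgeConjecture.HodgeConjecture.Theorems.Ring2AbelianAllAndreInvariantHodgeTypes
import Literature.AlgebraicGeometry.HodgeTheory.WeilClassesFieldAllOrNothing
import Literature.AlgebraicGeometry.Deligne1982.WeilTypeCMWeilClassesHodge
import HarnessLib

/-!
# Ring 2 · AbelianAll — ANDRÉ AXIS, PART R-c: WEIL TYPE RELATIVE TO A CM FIELD IS CONSTANT ALONG A COMPACT PENCIL WITH A GLOBAL `E`-ACTION —
  Deligne's condition `a_σ = d/2` (`IsWeilTypeCM`) at ONE charted member, plus one rational global class on `W_E ⊗ ℂ` there, non-zero on the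
  member, gives `IsWeilTypeCM` at EVERY member (fact-free: part R-a's flatness of `W_E ⊗ ℂ`, the Hodge type of flat sections of a compact abelian
  pencil, flat sections vanish nowhere, and Moonen–Zarhin's criterion — a theorem of the tree)

HONEST FRAMING (page 1, verbatim): **research route, not a corollary; conditional on HC_CM plus one named minimal statement.** Cell line:
research route conditional on HC_CM; not a corollary; Q11.4-sentence-2 already refuted in dim ≥ 3. Nothing in this file proves a case of the
Hodge conjecture or of `B(X)` for a named `X`; `HC_CM`, `HC_AV`, the global nodes and Verdier's binder are ABSENT. Item
`Theses.RankFourFaces.CMToAbelian` (stmt-16267) stays OPEN; N104 untouched; no node is born (0 `def`, 0 `sorry`, no named fact). Seat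
`pub-hodge-ring2-ab-andre-2`, gen 48 (part R: the André axis for CM fields). Part L-d (`…AndreWeilTypeTransport`, gen 42) proved the
imaginary-quadratic case: van Geemen's Weil type `(n, n)` of `(A_t, φ_t)` at one member passes to every member along a global class on the Weil
line `E₊`. Here `E = ℚ(φ) ≅ ℚ[T]/(R(T²))` is a CM field of any degree `2e₀` and «Weil type» is Deligne's `a_σ = k` at every embedding
(`Deligne1982.IsWeilTypeCM A φ R e₀ k`, (4.4)); the Weil line is replaced by `W_E ⊗ ℂ = weilClassesField A φ (R(T²)) (2k)`.

## Content (theorems only; standard axioms)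

* **`isOfHodgeType_chart_map_fiberι_of_member`** — bookkeeping: on a compact abelian pencil with charts `(A_s, e_s)`, if `e_t^*(W|X_t)` is of
  Hodge type `(p, q)` on `A_t` (ambient dimension `dim A_t`) then `e_s^*(W|X_s)` is of type `(p, q)` on `A_s` (ambient dimension `dim A_s`) —
  Deligne's (4.1.3.1) on the carriers (part XVI's `isOfHodgeType_map_fiberι_iff`) moved through the charts.
* **`isWeilTypeCM_member_of_member`** — THE ROW: compact pencil of abelian `d`-folds, global `Φ` over `S`, `Φ`-compatible charts `(A_s, e_s, φ_s)`
  with `R(φ_s²) = 0` on every chart, a rational global `U ∈ H^{2k}(𝒳(ℂ); ℂ)` with `e_t^*(U|X_t) ∈ W_E(A_t, φ_t) ⊗ ℂ` and `U|X_t ≠ 0`; if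
  `(A_t, φ_t)` is of Weil type relative to `E` (`IsWeilTypeCM (A t) (φ t) R e₀ k`) then so is `(A_s, φ_s)` for EVERY `s`. Proof: `e_s^*(U|X_s)`
  lies in `W_E(A_s) ⊗ ℂ` (part R-a), is rational, non-zero (flat sections vanish nowhere) and of type `(k, k)` (it is at `t` by Deligne's Prop. 4.4
  for the Weil-type member — the tree's `IsWeilTypeCM.isOfHodgeType_of_mem_weilClassesField'` — and Hodge types of restrictions of a global
  class are constant along the pencil); by Moonen–Zarhin's criterion (the tree's theorem `exists_isRationalClass_isOfHodgeType_ne_zero_iff_balanced`)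
  the multiplicities of `(A_s, φ_s)` are balanced, `n_ρ = n_ρ̄`, and `n_ρ + n_ρ̄ = 2k` (`eigenMultiplicity_add_eigenMultiplicity_conj_eq`), so
  `n_ρ = k`; the field data and `dim A_s = d = dim A_t = 2k·e₀` are as at `t`.
* **`isWeilTypeCM_member_iff_member`** — hence Weil type relative to `E` at any one member is equivalent to Weil type at any other.

## Honest status

Fact-free hypothesis-transport (the CM-field form of part L-d): with parts R-a (the classes), this file (the type) and L-a/L-c (discriminant and
rank data, stated for `K`-symmetrised classes — their CM-field forms are NOT done here, owed (o157)), the member-side hypotheses of the CM-field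
rows of part R-b read at ONE member. In print: Deligne's family clause «for all `s ∈ S`, `(Y_s, ν_s)` satisfies (4.4)» (LNM 900, proof of Thm.
4.8 (a)). Strength of the open instances unchanged; nothing minimal claimed; N104 untouched. EDGE LABELS: K (fact-free).
References: Deligne1982HodgeCycles (§4 (4.4), Prop. 4.4, proof of Thm. 4.8 (a), pp. 48–50; Milne 2003 re-edition endnote 16); MoonenZarhin1998WeilClasses
(§1 Criterion, Lemma (1)); DeligneHodgeII1971 ((4.1.3.1)); Andre1996Motifs (§5.1 p. 25, §6.3 Lemme 6.3.3); VoisinHodgeI2002 (Thm. 9.3, §9.2.1).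
-/

noncomputable section

set_option linter.dupNamespace false

namespace Summit.HodgeConjecture.HodgeConjecture.Ring2.AbelianAll

open CategoryTheory AlgebraicGeometry
open Literature.AlgebraicGeometry Literature.AlgebraicGeometry.Motives
open Literature.AlgebraicGeometry.HodgeTheory Literature.AlgebraicGeometry.Deligne1982
open Literature.AlgebraicTopology.SingularHomology (singularCohomology)

variable {𝒳 S : SchemeOver ℂ} {f : 𝒳 ⟶ S} {d : ℕ}

/-- **Hodge types of a flat class, read on the charts.** On a compact pencil of abelian `d`-folds with charts `e_s : A_s ≅ X_s`, a global class `W`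
whose charted restriction `e_t^*(W|X_t)` is of Hodge type `(p, q)` on `A_t` has `e_s^*(W|X_s)` of type `(p, q)` on `A_s` for every `s` (ambient
dimensions `dim A_t = d = dim A_s`). Deligne's (4.1.3.1) on the carriers (`isOfHodgeType_map_fiberι_iff`) and transport of Hodge types along the
chart isomorphisms. [cite: DeligneHodgeII1971, (4.1.3.1)] [cite: Andre1996Motifs, §5.1 (p. 25)] [cite: SerreGAGA1956, §2] -/
theorem isOfHodgeType_chart_map_fiberι_of_member (hf : IsCompactAbelianPencil f d)
    (A : ComplexPoints S → AbelianVariety ℂ) (e : ∀ s, (A s).X ≅ fiberOver f s) {k p q : ℕ} (W : complexBetti 𝒳 k) {t : ComplexPoints S}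
    (hWt : IsOfHodgeType (A t).dim (A t).X k p q (complexBetti.map (e t).hom k (complexBetti.map (fiberι f t) k W))) (s : ComplexPoints S) :
    IsOfHodgeType (A s).dim (A s).X k p q (complexBetti.map (e s).hom k (complexBetti.map (fiberι f s) k W)) := by
  rw [Andre1996.compactPencil_dim_eq_of_iso hf (e s)]
  rw [Andre1996.compactPencil_dim_eq_of_iso hf (e t)] at hWt
  exact (isOfHodgeType_map_iff_of_iso (e s)).2
    ((isOfHodgeType_map_fiberι_iff hf W s t).1 ((isOfHodgeType_map_iff_of_iso (e t)).1 hWt))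

/-- **WEIL TYPE RELATIVE TO A CM FIELD IS CONSTANT ALONG THE PENCIL (fact-free).** Let `f : 𝒳 ⟶ S` be a compact pencil of abelian `d`-folds with a
global endomorphism `Φ` over `S` and `Φ`-compatible charts `(A_s, e_s, φ_s)` on which `R(φ_s²) = 0` (`E = ℚ(φ) ≅ ℚ[T]/(R(T²))`), and let
`U ∈ H^{2k}(𝒳(ℂ); ℂ)` be a RATIONAL global class with `e_t^*(U|X_t) ∈ W_E(A_t, φ_t) ⊗ ℂ` and `U|X_t ≠ 0`. If `(A_t, φ_t)` is of Weil type relative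
to the CM field `E` (Deligne's `a_σ = k` at every embedding, `IsWeilTypeCM (A t) (φ t) R e₀ k`), then `(A_s, φ_s)` is of Weil type relative to `E`
for EVERY member `s`. The non-zero rational class `e_s^*(U|X_s)` of `W_E(A_s) ⊗ ℂ` (part R-a; flat sections vanish nowhere) is of type `(k, k)`
(Prop. 4.4 at `t`, constancy of Hodge types of flat classes), so Moonen–Zarhin's criterion forces `n_ρ = n_ρ̄`, and `n_ρ + n_ρ̄ = 2k`.
[cite: Deligne1982HodgeCycles, §4 Prop. 4.4 and proof of Thm. 4.8 (a) (pp. 48–50)] [cite: MoonenZarhin1998WeilClasses, §1 (Criterion)]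
[cite: DeligneHodgeII1971, (4.1.3.1)] [cite: Andre1996Motifs, §6.3 Lemme 6.3.3 (iii) (p. 33)] -/
theorem isWeilTypeCM_member_of_member (hf : IsCompactAbelianPencil f d)
    (Φ : 𝒳 ⟶ 𝒳) (hΦ : Φ ≫ f = f)
    (A : ComplexPoints S → AbelianVariety ℂ) (e : ∀ s, (A s).X ≅ fiberOver f s) (φ : ∀ s, A s ⟶ A s)
    (hK : ∀ s, ∃ Φs : fiberOver f s ⟶ fiberOver f s, Φs ≫ fiberι f s = fiberι f s ≫ Φ ∧ (e s).hom ≫ Φs = (φ s).hom.hom.hom ≫ (e s).hom)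
    {R : Polynomial ℤ} {e₀ k : ℕ}
    (hP : ∀ s, Polynomial.eval₂ (Int.castRingHom (CategoryTheory.End (A s))) ((φ s : CategoryTheory.End (A s)))
      (R.comp (Polynomial.X ^ 2)) = 0)
    (U : complexBetti 𝒳 (2 * k)) (hUQ : IsRationalClass U) {t : ComplexPoints S}
    (hUt : complexBetti.map (e t).hom (2 * k) (complexBetti.map (fiberι f t) (2 * k) U) ∈
      weilClassesField (A t) (φ t) (R.comp (Polynomial.X ^ 2)) (2 * k))
    (hU0 : complexBetti.map (fiberι f t) (2 * k) U ≠ 0)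
    (hWt : IsWeilTypeCM (A t) (φ t) R e₀ k) (s : ComplexPoints S) :
    IsWeilTypeCM (A s) (φ s) R e₀ k := by
  have hdim : (A s).dim = 2 * k * e₀ := by
    rw [Andre1996.compactPencil_dim_eq_of_iso hf (e s), ← Andre1996.compactPencil_dim_eq_of_iso hf (e t), hWt.dim_eq]
  have her : (2 * e₀) * (2 * k) = 2 * (A s).dim := by rw [hdim]; ring
  -- the transported class: in `W_E(A_s) ⊗ ℂ`, rational, non-zero, of type `(k, k)`
  have hW : complexBetti.map (e s).hom (2 * k) (complexBetti.map (fiberι f s) (2 * k) U) ∈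
      weilClassesField (A s) (φ s) (R.comp (Polynomial.X ^ 2)) (2 * k) :=
    map_chart_fiberι_mem_weilClassesField_member_of_member hf Φ hΦ A e φ hK U hUt s
  have hQ : IsRationalClass (complexBetti.map (e s).hom (2 * k) (complexBetti.map (fiberι f s) (2 * k) U)) :=
    (isRationalClass_map_iff_of_iso (e s)).2 (hUQ.map (AlgPoints.mapContinuous (L := ℂ) (fiberι f s)))
  have h0 : complexBetti.map (e s).hom (2 * k) (complexBetti.map (fiberι f s) (2 * k) U) ≠ 0 :=
    complexBetti.map_ne_zero_of_iso (e s) (2 * k) (map_fiberι_ne_zero_of_ne_zero hf hU0 s)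
  have hH : IsOfHodgeType (A s).dim (A s).X (2 * k) k k (complexBetti.map (e s).hom (2 * k) (complexBetti.map (fiberι f s) (2 * k) U)) :=
    isOfHodgeType_chart_map_fiberι_of_member hf A e U (hWt.isOfHodgeType_of_mem_weilClassesField' hUt) s
  -- Moonen–Zarhin: balanced multiplicities at `s`, and they add up to `2k`
  have hbal := (exists_isRationalClass_isOfHodgeType_ne_zero_iff_balanced (A := A s) (φ := φ s) hWt.monic_comp hWt.natDegree_comp
    hWt.irreducible (hP s) her (by have := hWt.k_pos; omega)).1
    ⟨_, hW, hQ, by rw [show 2 * k / 2 = k by omega]; exact hH, h0⟩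
  refine
    { e₀_pos := hWt.e₀_pos
      k_pos := hWt.k_pos
      monic := hWt.monic
      natDegree_eq := hWt.natDegree_eq
      irreducible := hWt.irreducible
      root_real_neg := hWt.root_real_neg
      eval₂_eq_zero := hP s
      dim_eq := hdim
      multiplicity_eq := fun ρ hρ ↦ ?_ }
  have hsum := eigenMultiplicity_add_eigenMultiplicity_conj_eq (A := A s) (φ := φ s) hWt.monic_comp hWt.natDegree_comp hWt.irreducible
    (hP s) her hρ
  have hb := hbal ρ hρ
  omega

/-- **Weil type relative to `E` at one member ⟺ at any other member** (symmetry of `isWeilTypeCM_member_of_member`; the flat class `U` is read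
at `t`, where it is assumed to lie in `W_E(A_t) ⊗ ℂ` and not to vanish). [cite: Deligne1982HodgeCycles, §4 Prop. 4.4 and proof of Thm. 4.8 (a) (pp. 48–50)]
[cite: MoonenZarhin1998WeilClasses, §1 (Criterion)] -/
theorem isWeilTypeCM_member_iff_member (hf : IsCompactAbelianPencil f d)
    (Φ : 𝒳 ⟶ 𝒳) (hΦ : Φ ≫ f = f)
    (A : ComplexPoints S → AbelianVariety ℂ) (e : ∀ s, (A s).X ≅ fiberOver f s) (φ : ∀ s, A s ⟶ A s)
    (hK : ∀ s, ∃ Φs : fiberOver f s ⟶ fiberOver f s, Φs ≫ fiberι f s = fiberι f s ≫ Φ ∧ (e s).hom ≫ Φs = (φ s).hom.hom.hom ≫ (e s).hom)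
    {R : Polynomial ℤ} {e₀ k : ℕ}
    (hP : ∀ s, Polynomial.eval₂ (Int.castRingHom (CategoryTheory.End (A s))) ((φ s : CategoryTheory.End (A s)))
      (R.comp (Polynomial.X ^ 2)) = 0)
    (U : complexBetti 𝒳 (2 * k)) (hUQ : IsRationalClass U) {t : ComplexPoints S}
    (hUt : complexBetti.map (e t).hom (2 * k) (complexBetti.map (fiberι f t) (2 * k) U) ∈
      weilClassesField (A t) (φ t) (R.comp (Polynomial.X ^ 2)) (2 * k))
    (hU0 : complexBetti.map (fiberι f t) (2 * k) U ≠ 0) (s s' : ComplexPoints S) :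
    IsWeilTypeCM (A s) (φ s) R e₀ k ↔ IsWeilTypeCM (A s') (φ s') R e₀ k :=
  ⟨fun h ↦ isWeilTypeCM_member_of_member hf Φ hΦ A e φ hK hP U hUQ
      (map_chart_fiberι_mem_weilClassesField_member_of_member hf Φ hΦ A e φ hK U hUt s) (map_fiberι_ne_zero_of_ne_zero hf hU0 s) h s',
    fun h ↦ isWeilTypeCM_member_of_member hf Φ hΦ A e φ hK hP U hUQ
      (map_chart_fiberι_mem_weilClassesField_member_of_member hf Φ hΦ A e φ hK U hUt s') (map_fiberι_ne_zero_of_ne_zero hf hU0 s') h s⟩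

end Summit.HodgeConjecture.HodgeConjecture.Ring2.AbelianAll

end
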